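import Summits.HodgeConjecture.HodgeConjecture.Theses.VHCAbelianSchemesRoad
import Summits.HodgeConjecture.HodgeConjecture.Theorems.VHCAbelianSchemesRoadDegreeConfinementItems
import Summits.HodgeConjecture.HodgeConjecture.Theorems.VHCAbelianSchemesRoadDiagonalTailItems
import Summits.HodgeConjecture.HodgeConjecture.Theorems.VHCAbelianSchemesRoadLocusEngineTailItems
import Summits.HodgeConjecture.HodgeConjecture.Theorems.VHCAbelianSchemesRoadAnchorReachableSeam
import HarnessLib

/-!
# CENSUS CERTIFICATE (leafhand-hodge-vhcabelianschemesr-1 gen 0, 2026-08-30) — the NINE registered `stub_*` of the three seatless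
# items stmt-HodgeConjecture-23176 ∕ 19274 ∕ 19779 of route `VHCAbelianSchemesRoad`, classified IN THE KERNEL by name

research route conditional on HC_CM; not a corollary; Q11.4-sentence-2 already refuted in dim ≥ 3.

HYPOTHESIS-FORM THEOREMS ONLY (every `stub_*` statement of the three registered skeletons enters as a HYPOTHESIS, spelled verbatim;
nothing is asserted; no `sorry`; `HC_CM` occurs nowhere). Crux workfile ∕ evidence, NOT a Theorems landing. What it certifies:

§1 asides 19274 (`…TwAt`, skeleton v4 5bdc755d) and 19779 (`…LefAt`, skeleton v4 affed814): each item's stub 2 IS the item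
   (`Iff`, degree confinement p442807∕p443066); 19779-stub 2 ⟹ 19274-stub 2 (sheaf door ≤ twisted door); the rungs are instances; and the
   DIAGONAL TAIL `m ≥ 4` of 19274-stub 2 ALONE gives `HC_AV` with the four classical binders of the route (`hc_av_of_twAtDiagTail_four`,
   fact-free) — so neither aside is a leaf: closing either stub 2 in Lean is proving `HC_AV` (modulo the door ∕ Raynaud ∕ André binders).
§2 parent 23176 (`…TwPrimeAtDiagLocal`, skeleton v3.7 51bf0ebf, SPLIT rev 27 into 26511 + 26512 + glue 26513): stubs 1′ and 3′ᴸ are the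
   SAME TERMS as the live child 26512's stubs of the same names (`Iff.rfl`); 3′ᴸ alone gives `HC_AV` (`hc_av_of_twPrimeAtDiagLocal_four`);
   2r′ (anchor family «pinned ∧ off-hyperelliptic presentation») FOLLOWS from 26512's 2r″ (family «… ∧ H_disj ∧ End-trivial») by
   `localResidualPairs_antitone`; 2ℓ′ (H-free ∀-form of Markman's pinned claim) IMPLIES the route decl `MarkmanPinnedForallTwPrime`
   (item 26511, the H-displayed Literature claim) — the converse is exactly refute-markman WAKE #8's missing `OrbitTranslatesDisjoint`, so 2ℓ′
   is STRONGER THAN PRINT and not closable from the Literature name.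
Nothing here says any stub, any of the five items, `HC_AV` or `HC` holds; typed ≠ proved.
-/

noncomputable section

open CategoryTheory CategoryTheory.Limits AlgebraicGeometry Topology
open Literature.AlgebraicGeometry Literature.AlgebraicGeometry.Motives Literature.AlgebraicGeometry.Motives.AbelianVariety
open Literature.AlgebraicGeometry.HodgeTheory Literature.AlgebraicGeometry.Markman2025
open Literature.AlgebraicTopology.SingularHomology
open Literature.Barriers.HodgeConjecture (divisorClassesSpan)
open Summit.Ventures.HSemireg (ObjClass bfSheafClass)
open Summit.HodgeConjecture.HodgeConjecture.Ring2.SemiregularRepresentatives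
open Summit.HodgeConjecture.HodgeConjecture

namespace Summit.HodgeConjecture.HodgeConjecture.Cruxes.SemiregularSheafRepresentativesTwPrimeAtDiagLocal.CensusLeafhandG0

set_option linter.dupNamespace false

/-! ## §1 The asides 19274 ∕ 19779 -/

/-- 19274's `stub_exceptionalRegimeTw_midRange` IS the item (type = the route decl). [cite: vanGeemen1994HodgeAV, §2.4] -/
theorem item19274_iff_stub2 :
    Theses.VHCAbelianSchemesRoad.SemiregularSheafRepresentativesTwAt ↔
      ∀ (C : ChernCharacterBetti) (n p : ℕ), 2 ≤ p → p + 2 ≤ n →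
        LefAtExceptionalRegimeAt (twistedReflexiveClass C
          (fun n X₀ I E => Summit.Ventures.HSemireg.gluableSigmaAdmissible n X₀ I E ∨ bfSingleAdmissible n X₀ I E)) n p :=
  semiregularSheafRepresentativesTwAt_iff_midRange

/-- 19779's `stub_exceptionalRegime_midRange` IS the item (type = the route decl). [cite: BuchweitzFlenner2003, §5 Thm. 5.1] -/
theorem item19779_iff_stub2 :
    Theses.VHCAbelianSchemesRoad.SemiregularSheafRepresentativesLefAt ↔
      ∀ (C : ChernCharacterBetti) (n p : ℕ), 2 ≤ p → p + 2 ≤ n → LefAtExceptionalRegimeAt (bfSheafClass C) n p :=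
  semiregularSheafRepresentativesLefAt_route_iff_midRange

/-- 19779-stub 2 ⟹ 19274-stub 2 (the sheaf door is inside the twisted door, `B₀ = 0`). [cite: BuchweitzFlenner2003, §5 Thm. 5.1] -/
theorem stub2_19274_of_stub2_19779
    (h : ∀ (C : ChernCharacterBetti) (n p : ℕ), 2 ≤ p → p + 2 ≤ n → LefAtExceptionalRegimeAt (bfSheafClass C) n p) :
    ∀ (C : ChernCharacterBetti) (n p : ℕ), 2 ≤ p → p + 2 ≤ n →
      LefAtExceptionalRegimeAt (twistedReflexiveClass C
        (fun n X₀ I E => Summit.Ventures.HSemireg.gluableSigmaAdmissible n X₀ I E ∨ bfSingleAdmissible n X₀ I E)) n p :=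
  fun C n p hp hn ↦ lefAtExceptionalRegimeAt_twisted_of_sheaf C (fun _ _ _ _ h ↦ Or.inr h) (h C n p hp hn)

/-- The rungs `stub_rung_sixfoldMiddleTw` ∕ `stub_rung_sixfoldMiddle` are the cell `(6, 3)` of the respective stub 2 (`Iff.rfl` on the rung
predicate). [cite: Markman2025SecantWeil, Thm. 1.5.1] -/
theorem rungs_of_stub2 {𝒪 : ChernCharacterBetti → ObjClass}
    (h : ∀ (C : ChernCharacterBetti) (n p : ℕ), 2 ≤ p → p + 2 ≤ n → LefAtExceptionalRegimeAt (𝒪 C) n p) :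
    ∀ C : ChernCharacterBetti, LefAtExceptionalRegimeSixfoldMiddle (𝒪 C) :=
  fun C ↦ h C 6 3 (by norm_num) (by norm_num)

/-- **19274-stub 2 is `HC_AV`-complete**: its diagonal tail `(2m, m)`, `m ≥ 4`, alone gives the leaf with the route's four classical
binders (K-C, the twisted door, Raynaud, André) — `hc_av_of_twAtDiagTail_four`, fact-free. [cite: Andre1996Motifs, §6.3 Lemmes 6.3.1–6.3.3]
[cite: BrosnanFangNiePearlstein2009, §6 Lemma 48] -/
theorem hc_av_of_stub2_19274 (hC : Theses.VHCAbelianSchemesRoad.ChernCharacterOnBetti)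
    (h : ∀ (C : ChernCharacterBetti) (n p : ℕ), 2 ≤ p → p + 2 ≤ n →
      LefAtExceptionalRegimeAt (twistedReflexiveClass C
        (fun n X₀ I E => Summit.Ventures.HSemireg.gluableSigmaAdmissible n X₀ I E ∨ bfSingleAdmissible n X₀ I E)) n p)
    (hDoor : Theses.VHCAbelianSchemesRoad.TwistedPerfectDoor) (hR : Theses.VHCAbelianSchemesRoad.RaynaudSectionProjective)
    (h₂₁ : Theses.VHCAbelianSchemesRoad.AndreCMAnchoredPencil) (h₂₂ : Theses.VHCAbelianSchemesRoad.AndreAnchoredPencilsAlgebraic) :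
    Theses.PadicSemiregularLift.HodgeAbelianVarieties :=
  hc_av_of_twAtDiagTail_four hC (fun C m hm ↦ h C (2 * m) m (by omega) (by omega)) hDoor hR h₂₁ h₂₂

/-- **19779-stub 2 is `HC_AV`-complete** (through 19274-stub 2). [cite: Andre1996Motifs, §6.3 Lemmes 6.3.1–6.3.3] -/
theorem hc_av_of_stub2_19779 (hC : Theses.VHCAbelianSchemesRoad.ChernCharacterOnBetti)
    (h : ∀ (C : ChernCharacterBetti) (n p : ℕ), 2 ≤ p → p + 2 ≤ n → LefAtExceptionalRegimeAt (bfSheafClass C) n p)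
    (hDoor : Theses.VHCAbelianSchemesRoad.TwistedPerfectDoor) (hR : Theses.VHCAbelianSchemesRoad.RaynaudSectionProjective)
    (h₂₁ : Theses.VHCAbelianSchemesRoad.AndreCMAnchoredPencil) (h₂₂ : Theses.VHCAbelianSchemesRoad.AndreAnchoredPencilsAlgebraic) :
    Theses.PadicSemiregularLift.HodgeAbelianVarieties :=
  hc_av_of_stub2_19274 hC (stub2_19274_of_stub2_19779 h) hDoor hR h₂₁ h₂₂

/-! ## §2 The parent 23176 against its live child 26512 and the print input 26511 -/

/-- **3′ᴸ `stub_diagonalTailTwPrimeLocal` (shared verbatim by 23176 and 26512) is `HC_AV`-complete** with the five other binders of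
`closes` — `hc_av_of_twPrimeAtDiagLocal_four`, fact-free. [cite: Andre1996Motifs, §6.3 Lemmes 6.3.1–6.3.3] -/
theorem hc_av_of_stub_tail_23176 (hC : Theses.VHCAbelianSchemesRoad.ChernCharacterOnBetti)
    (hTail : ∀ (C : ChernCharacterBetti) (m : ℕ), 4 ≤ m →
      LefAtExceptionalRegimeAtLocal (twistedReflexiveClass C
        (fun n X₀ I E => Summit.Ventures.HSemireg.gluableSigmaAdmissible n X₀ I E ∨ bfSingleAdmissible' n X₀ I E)) (2 * m) m)
    (hDoor : Theses.VHCAbelianSchemesRoad.TwistedPerfectDoorPrime) (hR : Theses.VHCAbelianSchemesRoad.RaynaudSectionProjective)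
    (h₂₁ : Theses.VHCAbelianSchemesRoad.AndreCMAnchoredPencil) (h₂₂ : Theses.VHCAbelianSchemesRoad.AndreAnchoredPencilsAlgebraic) :
    Theses.PadicSemiregularLift.HodgeAbelianVarieties :=
  hc_av_of_twPrimeAtDiagLocal_four hC hTail hDoor hR h₂₁ h₂₂

/-- **2r′ ⟸ 2r″**: the parent's residual stub `stub_localResidualPairs_63_OffHypTwPrime` (pairs unreachable from the pinned anchors with an
OFF-HYPERELLIPTIC presentation) follows from the child's `stub_localResidualPairs_63_OffHypDisjEndTwPrime` (unreachable from the SMALLER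
family: presentation moreover `OrbitTranslatesDisjoint` and `End`-trivial), by `localResidualPairs_antitone`. [cite: Markman2025SecantWeil, Thm. 1.5.1] -/
theorem parent_residual_of_child_residual (C : ChernCharacterBetti)
    (h : ∀ (X : SchemeOver ℂ), (∃ A' : AbelianVariety ℂ, A'.dim = 6 ∧ Nonempty (A'.X ≅ X)) →
      ∀ w : complexBetti X (2 * 3), IsRationalClass w → IsOfHodgeType 6 X (2 * 3) 3 3 w →
        ¬ (w ∈ algebraicClasses X 3 ∧ w ∈ divisorClassesSpan X 6 3) →
        ¬ AnchorReachableAt 6 3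
            (fun Y θ ↦ secantQuotientAnchorsPinned Y θ ∧ ∃ (D : SecantQuotientDatum) (e : Y ≅ D.Y.X) (θ₀ : complexBetti D.𝒥.J.X 2),
              ¬ D.𝒥.IsHyperelliptic ∧ OrbitTranslatesDisjoint D.𝒥 D.G₁ D.G₂ ∧ D.𝒥.J.IsPolarizationClassOf D.Θ θ₀ ∧
              (∀ f : D.𝒥.J ⟶ D.𝒥.J, ∃ n : ℤ, f = n • 𝟙 D.𝒥.J) ∧ complexBetti.map e.inv 2 θ = D.hY θ₀)
            (fun Y θ ↦ secantQuotientServedClassesPinned Y θ)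
            (fun Y θ ↦ {w | ∃ γ, (γ = 0 ∨ γ ∈ secantQuotientServedClassesPinned Y θ) ∧ ∃ z : ℂ, w = γ + z • cupPowTwo θ 3}) X w →
        LocallyServedAt (twistedReflexiveClass C
          (fun n X₀ I E => Summit.Ventures.HSemireg.gluableSigmaAdmissible n X₀ I E ∨ bfSingleAdmissible' n X₀ I E)) 6 3 X w) :
    ∀ (X : SchemeOver ℂ), (∃ A' : AbelianVariety ℂ, A'.dim = 6 ∧ Nonempty (A'.X ≅ X)) →
      ∀ w : complexBetti X (2 * 3), IsRationalClass w → IsOfHodgeType 6 X (2 * 3) 3 3 w →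
        ¬ (w ∈ algebraicClasses X 3 ∧ w ∈ divisorClassesSpan X 6 3) →
        ¬ AnchorReachableAt 6 3
            (fun Y θ ↦ secantQuotientAnchorsPinned Y θ ∧ ∃ (D : SecantQuotientDatum) (e : Y ≅ D.Y.X) (θ₀ : complexBetti D.𝒥.J.X 2),
              ¬ D.𝒥.IsHyperelliptic ∧ D.𝒥.J.IsPolarizationClassOf D.Θ θ₀ ∧ complexBetti.map e.inv 2 θ = D.hY θ₀)
            (fun Y θ ↦ secantQuotientServedClassesPinned Y θ)
            (fun Y θ ↦ {w | ∃ γ, (γ = 0 ∨ γ ∈ secantQuotientServedClassesPinned Y θ) ∧ ∃ z : ℂ, w = γ + z • cupPowTwo θ 3}) X w →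
        LocallyServedAt (twistedReflexiveClass C
          (fun n X₀ I E => Summit.Ventures.HSemireg.gluableSigmaAdmissible n X₀ I E ∨ bfSingleAdmissible' n X₀ I E)) 6 3 X w :=
  localResidualPairs_antitone (fun _ _ hY ↦ by
    obtain ⟨hpin, D, e, θ₀, hnh, _hdisj, hpol, _hend, hmap⟩ := hY
    exact ⟨hpin, D, e, θ₀, hnh, hpol, hmap⟩) h

/-- **2ℓ′ ⟹ 26511**: the parent's H-free stub `stub_markmanPinnedForall_TwPrime` implies the route decl `MarkmanPinnedForallTwPrime` (the
Literature claim WITH `OrbitTranslatesDisjoint` displayed) by dropping that binder; the converse is not derivable (WAKE #8: H_disj is not implied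
by the other binders), which is why 2ℓ′ is stronger than print. [cite: Markman2025SecantWeil, §9.1 (p. 57) standing assumption and Lemma 9.1.4] -/
theorem item26511_of_stub_2l
    (h : ∀ C : ChernCharacterBetti, ∀ d : ℕ, Even d → 4 ≤ d →
      ∀ (Cᵥ : SchemeOver ℂ) (_ : IsSmoothProjective 1 Cᵥ) (𝒥 : Jacobian Cᵥ) (_ : 𝒥.J.dim = 3)
        (Θ : CartierDivisor 𝒥.J.X.left) (_ : 𝒥.IsRiemannThetaDivisor Θ) (hP : 𝒥.J.IsPrincipalPolarizationDivisor Θ)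
        (G₁ G₂ : Subgroup (𝒥.J.Points ℂ)) (h₁ : G₁ ≤ 𝒥.J.torsionPoints ℂ (d + 1 : ℕ))
        (h₂ : G₂ ≤ 𝒥.J.torsionPoints ℂ (d + 1 : ℕ)),
        ¬ 𝒥.IsHyperelliptic →
        IsCyclic G₁ → Nat.card G₁ = d + 1 → IsCyclic G₂ → Nat.card G₂ = d + 1 → G₁ ⊓ G₂ = ⊥ →
        TranslatesInGeneralPosition 𝒥.J Θ (sumSet G₁ G₂) →
        ∀ θ₀ : complexBetti 𝒥.J.X 2, 𝒥.J.IsPolarizationClassOf Θ θ₀ →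
          ∃ γ, IsTwistedCarrierWeilPairOn C
            (fun n X₀ I E => Summit.Ventures.HSemireg.gluableSigmaAdmissible n X₀ I E ∨ bfSingleAdmissible' n X₀ I E)
            𝒥.J hP.isAmple hP.KTheta_eq_bot G₁ G₂ (Nat.succ_ne_zero d) h₁ h₂ d
            (secantPolarizationClass 𝒥.J hP.isAmple G₁ G₂ (Nat.succ_ne_zero d) h₁ h₂ d θ₀) γ) :
    Theses.VHCAbelianSchemesRoad.MarkmanPinnedForallTwPrime :=
  fun C d hd h4 Cᵥ hCᵥ 𝒥 h𝒥 Θ hΘ hP G₁ G₂ h₁ h₂ hnh _hdisj ↦ h C d hd h4 Cᵥ hCᵥ 𝒥 h𝒥 Θ hΘ hP G₁ G₂ h₁ h₂ hnh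

/-- **The parent from its two children is the glue item 26513** (modus ponens; landed separately as
`Theorems/VHCAbelianSchemesRoadSemiregularSheafRepresentativesTwPrimeAtDiagLocalGlue.lean`). [cite: Markman2025SecantWeil, Thm. 1.5.1] -/
theorem item23176_of_children (h₁ : Theses.VHCAbelianSchemesRoad.MarkmanPinnedForallTwPrime)
    (h₂ : Theses.VHCAbelianSchemesRoad.DiagLocalOfMarkmanPinnedForall) :
    Theses.VHCAbelianSchemesRoad.SemiregularSheafRepresentativesTwPrimeAtDiagLocal :=
  h₂ h₁

#print axioms hc_av_of_stub2_19779
#print axioms parent_residual_of_child_residual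
#print axioms item26511_of_stub_2l

end Summit.HodgeConjecture.HodgeConjecture.Cruxes.SemiregularSheafRepresentativesTwPrimeAtDiagLocal.CensusLeafhandG0

end
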